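import Mathlib

/-!
# CuspSurfaces — 1620 explicit degree-12 surfaces on every member of the Dwork sextic pencil (solo-blind s88)

Solo-blind programme, `work/s88/cusp-surfaces.md` (claims SB-C715–SB-C717); Mathlib only, nothing of the
programme's tree is imported, and only polynomial identities are formalised (no schemes, no cohomology).

Informal setting.  `X_ψ : F_ψ = x₁⁶ + ⋯ + x₆⁶ + ψ·x₁x₂x₃x₄x₅x₆ = 0` in `ℙ⁵`.  Split the variables `3 + 3`,
`I = {1,2,3}`, `J = {4,5,6}`, `m_I = x₁x₂x₃`, `m_J = x₄x₅x₆`, `P_I = x₁⁶+x₂⁶+x₃⁶`.  Newton's identity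
`a + b + c = 0 ⇒ a³ + b³ + c³ = 3abc` applied to `a = x₁², b = ω^a x₂², c = ω^b x₃²` (`ω³ = 1`) gives
`P_I = 3 ω^{a+b} m_I²` on the quadric cone `Q_{ab}(x_I) = x₁² + ω^a x₂² + ω^b x₃² = 0`, hence on
`Q_{ab}(x_I) = Q_{de}(x_J) = 0` the sextic `F_ψ` restricts to the binary quadratic
`3ω^{a+b} m_I² + ψ m_I m_J + 3ω^{d+e} m_J²`, and for every root `r` of `3ω^{a+b} r² + ψ r + 3ω^{d+e} = 0` the
complete intersection `S = {Q_{ab}(x_I) = 0, Q_{de}(x_J) = 0, m_I = r·m_J}` (type `(2,2,3)`, degree 12) lies on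
`X_ψ`.  Over the ten `3+3` splittings this gives `10·9·9·2 = 1620` surfaces, defined over
`ℚ(ω, √(ψ² − 36 ω^{a+b+d+e}))`.  At `ψ = 10` the untwisted ones are rational:
`3m² + 10mm′ + 3m′² = (3m + m′)(m + 3m′)`, so `X₁₀ ⊃ {x₁²+x₂²+x₃² = 0, x₄²+x₅²+x₆² = 0, 3x₁x₂x₃ + x₄x₅x₆ = 0}`.

What is certified here (over an arbitrary commutative ring `R`, `ω` any element with `ω² + ω + 1 = 0`):
* `newton_cube` : `a + b + c = 0 → a³ + b³ + c³ = 3abc`;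
* `sextic_split` : `x⁶+y⁶+z⁶ − 3(xyz)² = (x²+y²+z²)(x⁴+y⁴+z⁴−x²y²−y²z²−z²x²)`;
* `F_three_products` : `F_ψ = Q(x_I)·R(x_I) + Q(x_J)·R(x_J) + (3m_I² + ψ m_I m_J + 3m_J²)` and
  `F10_three_products` : `F₁₀ = Q(x_I)R(x_I) + Q(x_J)R(x_J) + (3m_I + m_J)(m_I + 3m_J)`;
* `cusp_surface_mem` : `3r² + ψr + 3 = 0`, `Q(x_I) = 0`, `Q(x_J) = 0`, `m_I = r m_J` `⇒ F_ψ(x) = 0`;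
  `cusp_surface_plus_mem_X10`, `cusp_surface_minus_mem_X10` : the two rational surfaces on `X₁₀`;
* `cone_power_sum`, `cone_power_sum_twisted` : `P_I = 3m_I²` on `x₁² + ωx₂² + ω²x₃² = 0` and
  `P_I = 3ω m_I²` on `x₁² + ωx₂² + x₃² = 0`;
* `cusp_surface_twisted_mem` : the twisted case `3ω r² + ψ r + 3 = 0`, `x₁² + ωx₂² + x₃² = 0`,
  `x₄²+x₅²+x₆² = 0`, `m_I = r m_J ⇒ F_ψ = 0`.

Consequence drawn in the note, not here: these surfaces move with `ψ` over a finite cover of the pencil, so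
their classes are orthogonal to the rank-5 invariant piece `W₀` (monodromy Zariski-dense in `O(5)`); they do
NOT carry the special Hodge class at `ψ = 10`, but their fields of definition reproduce its Tate character and
the real-multiplication discriminant of its complement (dictionary in the note).
-/

set_option linter.dupNamespace false

namespace Summit.HodgeConjecture.HodgeConjecture.Theorems

namespace SoloBlindCuspSurfaces

variable {R : Type*} [CommRing R]

/-- Newton's identity for three quantities summing to zero. -/
theorem newton_cube (a b c : R) (h : a + b + c = 0) : a ^ 3 + b ^ 3 + c ^ 3 = 3 * a * b * c := by
  linear_combination (a ^ 2 + b ^ 2 + c ^ 2 - a * b - b * c - c * a) * h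

/-- The diagonal quadric in three variables. -/
def Q (x y z : R) : R := x ^ 2 + y ^ 2 + z ^ 2

/-- The quartic cofactor `x⁴+y⁴+z⁴−x²y²−y²z²−z²x²` (product of the two `ω`-twisted conics). -/
def Rq (x y z : R) : R := x ^ 4 + y ^ 4 + z ^ 4 - x ^ 2 * y ^ 2 - y ^ 2 * z ^ 2 - z ^ 2 * x ^ 2

/-- The Dwork sextic `F_ψ(x) = Σ xᵢ⁶ + ψ·x₁⋯x₆`. -/
def F (ψ x₁ x₂ x₃ x₄ x₅ x₆ : R) : R :=
  x₁ ^ 6 + x₂ ^ 6 + x₃ ^ 6 + x₄ ^ 6 + x₅ ^ 6 + x₆ ^ 6 + ψ * (x₁ * x₂ * x₃ * x₄ * x₅ * x₆)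

/-- `x⁶+y⁶+z⁶ − 3(xyz)² = Q · Rq`. -/
theorem sextic_split (x y z : R) :
    x ^ 6 + y ^ 6 + z ^ 6 - 3 * (x * y * z) ^ 2 = Q x y z * Rq x y z := by
  unfold Q Rq; ring

/-- The three-products form of the Dwork sextic for the splitting `{1,2,3} ⊔ {4,5,6}`. -/
theorem F_three_products (ψ x₁ x₂ x₃ x₄ x₅ x₆ : R) :
    F ψ x₁ x₂ x₃ x₄ x₅ x₆ =
      Q x₁ x₂ x₃ * Rq x₁ x₂ x₃ + Q x₄ x₅ x₆ * Rq x₄ x₅ x₆ +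
        (3 * (x₁ * x₂ * x₃) ^ 2 + ψ * ((x₁ * x₂ * x₃) * (x₄ * x₅ * x₆)) + 3 * (x₄ * x₅ * x₆) ^ 2) := by
  unfold F Q Rq; ring

/-- At `ψ = 10` the binary quadratic factors over `ℤ`: `F₁₀ = Q·Rq + Q·Rq + (3m + m′)(m + 3m′)`. -/
theorem F10_three_products (x₁ x₂ x₃ x₄ x₅ x₆ : R) :
    F 10 x₁ x₂ x₃ x₄ x₅ x₆ =
      Q x₁ x₂ x₃ * Rq x₁ x₂ x₃ + Q x₄ x₅ x₆ * Rq x₄ x₅ x₆ +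
        (3 * (x₁ * x₂ * x₃) + x₄ * x₅ * x₆) * (x₁ * x₂ * x₃ + 3 * (x₄ * x₅ * x₆)) := by
  unfold F Q Rq; ring

/-- The untwisted cusp surface lies on `X_ψ`: if `3r² + ψr + 3 = 0` then
`{Q(x_I) = 0, Q(x_J) = 0, m_I = r·m_J} ⊂ {F_ψ = 0}` (pointwise, over any commutative ring). -/
theorem cusp_surface_mem (ψ r x₁ x₂ x₃ x₄ x₅ x₆ : R) (hr : 3 * r ^ 2 + ψ * r + 3 = 0)
    (hI : Q x₁ x₂ x₃ = 0) (hJ : Q x₄ x₅ x₆ = 0) (hm : x₁ * x₂ * x₃ = r * (x₄ * x₅ * x₆)) :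
    F ψ x₁ x₂ x₃ x₄ x₅ x₆ = 0 := by
  rw [F_three_products]
  linear_combination (Rq x₁ x₂ x₃) * hI + (Rq x₄ x₅ x₆) * hJ +
    (3 * (x₁ * x₂ * x₃ + r * (x₄ * x₅ * x₆)) + ψ * (x₄ * x₅ * x₆)) * hm + (x₄ * x₅ * x₆) ^ 2 * hr

/-- `S₊ = {x₁²+x₂²+x₃² = 0, x₄²+x₅²+x₆² = 0, 3x₁x₂x₃ + x₄x₅x₆ = 0} ⊂ X₁₀` (defined over `ℚ`). -/
theorem cusp_surface_plus_mem_X10 (x₁ x₂ x₃ x₄ x₅ x₆ : R)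
    (hI : Q x₁ x₂ x₃ = 0) (hJ : Q x₄ x₅ x₆ = 0) (hm : 3 * (x₁ * x₂ * x₃) + x₄ * x₅ * x₆ = 0) :
    F 10 x₁ x₂ x₃ x₄ x₅ x₆ = 0 := by
  rw [F10_three_products]
  linear_combination (Rq x₁ x₂ x₃) * hI + (Rq x₄ x₅ x₆) * hJ + (x₁ * x₂ * x₃ + 3 * (x₄ * x₅ * x₆)) * hm

/-- `S₋ = {x₁²+x₂²+x₃² = 0, x₄²+x₅²+x₆² = 0, x₁x₂x₃ + 3x₄x₅x₆ = 0} ⊂ X₁₀` (defined over `ℚ`). -/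
theorem cusp_surface_minus_mem_X10 (x₁ x₂ x₃ x₄ x₅ x₆ : R)
    (hI : Q x₁ x₂ x₃ = 0) (hJ : Q x₄ x₅ x₆ = 0) (hm : x₁ * x₂ * x₃ + 3 * (x₄ * x₅ * x₆) = 0) :
    F 10 x₁ x₂ x₃ x₄ x₅ x₆ = 0 := by
  rw [F10_three_products]
  linear_combination (Rq x₁ x₂ x₃) * hI + (Rq x₄ x₅ x₆) * hJ + (3 * (x₁ * x₂ * x₃) + x₄ * x₅ * x₆) * hm

/-- A non-root control: the coefficient `2` is NOT allowed — `F₁₀ − (Q·Rq + Q·Rq) − (2m + m′)(…)` is the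
nonzero form `(3m+m′)(m+3m′) − (2m+m′)(m+3m′) = m(m+3m′)`; recorded as the identity it is. -/
theorem control_identity (m m' : R) :
    (3 * m + m') * (m + 3 * m') - (2 * m + m') * (m + 3 * m') = m * (m + 3 * m') := by ring

/-- On the cone `x₁² + ωx₂² + ω²x₃² = 0` (`ω² + ω + 1 = 0`) the power sum is `3m²`. -/
theorem cone_power_sum (ω x₁ x₂ x₃ : R) (hω : ω ^ 2 + ω + 1 = 0)
    (hQ : x₁ ^ 2 + ω * x₂ ^ 2 + ω ^ 2 * x₃ ^ 2 = 0) :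
    x₁ ^ 6 + x₂ ^ 6 + x₃ ^ 6 = 3 * (x₁ * x₂ * x₃) ^ 2 := by
  have h3 : ω ^ 3 = 1 := by linear_combination (ω - 1) * hω
  have key := newton_cube (x₁ ^ 2) (ω * x₂ ^ 2) (ω ^ 2 * x₃ ^ 2) hQ
  linear_combination key - (x₂ ^ 6 + (ω ^ 3 + 1) * x₃ ^ 6 - 3 * (x₁ * x₂ * x₃) ^ 2) * h3

/-- On the twisted cone `x₁² + ωx₂² + x₃² = 0` the power sum is `3ω·m²`. -/
theorem cone_power_sum_twisted (ω x₁ x₂ x₃ : R) (hω : ω ^ 2 + ω + 1 = 0)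
    (hQ : x₁ ^ 2 + ω * x₂ ^ 2 + x₃ ^ 2 = 0) :
    x₁ ^ 6 + x₂ ^ 6 + x₃ ^ 6 = 3 * ω * (x₁ * x₂ * x₃) ^ 2 := by
  have h3 : ω ^ 3 = 1 := by linear_combination (ω - 1) * hω
  have key := newton_cube (x₁ ^ 2) (ω * x₂ ^ 2) (x₃ ^ 2) hQ
  linear_combination key - (x₂ ^ 6) * h3

/-- The twisted cusp surface: `3ω r² + ψ r + 3 = 0`, `x₁² + ωx₂² + x₃² = 0`, `x₄² + x₅² + x₆² = 0`,
`m_I = r·m_J ⇒ F_ψ = 0`.  (Field of definition `ℚ(ω, √(ψ² − 36ω))`; at `ψ = 10` its norm is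
`14896 = 2⁴·7²·19`.) -/
theorem cusp_surface_twisted_mem (ω ψ r x₁ x₂ x₃ x₄ x₅ x₆ : R) (hω : ω ^ 2 + ω + 1 = 0)
    (hr : 3 * ω * r ^ 2 + ψ * r + 3 = 0)
    (hI : x₁ ^ 2 + ω * x₂ ^ 2 + x₃ ^ 2 = 0) (hJ : Q x₄ x₅ x₆ = 0)
    (hm : x₁ * x₂ * x₃ = r * (x₄ * x₅ * x₆)) :
    F ψ x₁ x₂ x₃ x₄ x₅ x₆ = 0 := by
  have hPI := cone_power_sum_twisted ω x₁ x₂ x₃ hω hI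
  have hPJ : x₄ ^ 6 + x₅ ^ 6 + x₆ ^ 6 = 3 * (x₄ * x₅ * x₆) ^ 2 := by
    linear_combination (Rq x₄ x₅ x₆) * hJ + sextic_split x₄ x₅ x₆
  unfold F
  linear_combination hPI + hPJ +
    (3 * ω * (x₁ * x₂ * x₃ + r * (x₄ * x₅ * x₆)) + ψ * (x₄ * x₅ * x₆)) * hm + (x₄ * x₅ * x₆) ^ 2 * hr

/-- The norm computation behind the dictionary: `N(ψ² − 36ω) = ψ⁴ + 36ψ² + 1296` (as an identity using
`ω + ω̄ = −1`, `ωω̄ = 1`, i.e. `(T − 36ω)(T − 36ω′)` with `ω + ω′ = −1`, `ωω′ = 1`). -/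
theorem disc_norm (T ω ω' : R) (hs : ω + ω' = -1) (hp : ω * ω' = 1) :
    (T - 36 * ω) * (T - 36 * ω') = T ^ 2 + 36 * T + 1296 := by
  linear_combination (-36 * T) * hs + 1296 * hp

/-- The three RM parameters: `ψ² = 100, −64, −2880` give `ψ⁴ + 36ψ² + 1296 = 2⁴·7²·19`, `2⁴·193`,
`2⁴·3⁴·7²·129` and `ψ² − 36 = 8², −10², −54²` (the numbers `19, 193, 129` are the real-multiplication
discriminants found in s85, and the squares are the rational splitting of the untwisted cusp quadratic). -/
theorem rm_parameters :
    (100 : ℤ) ^ 2 + 36 * 100 + 1296 = 2 ^ 4 * 7 ^ 2 * 19 ∧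
    (-64 : ℤ) ^ 2 + 36 * (-64) + 1296 = 2 ^ 4 * 193 ∧
    (-2880 : ℤ) ^ 2 + 36 * (-2880) + 1296 = 2 ^ 4 * 3 ^ 4 * 7 ^ 2 * 129 ∧
    (100 : ℤ) - 36 = 8 ^ 2 ∧ (-64 : ℤ) - 36 = -(10 ^ 2) ∧ (-2880 : ℤ) - 36 = -(54 ^ 2) := by
  norm_num

end SoloBlindCuspSurfaces

end Summit.HodgeConjecture.HodgeConjecture.Theorems
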